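import Literature.NumberTheory.PAdicHodge.BmaxPlusPhiRoadThetaBOmega
import Literature.NumberTheory.EllipticCurves.SecondKindColmezFunctionalHodgeLine
import HarnessLib

/-!
# `θ(f Λ_N(ι y₀, z)) = p^N · log_W(θ(y₀))` for EVERY `y₀ ∈ 𝔸_inf` with `‖θ(y₀)‖ < 1` (any depth `N`): the θ-value of the honest
# `B_dR⁺`-image of an `A_max`-period is `p^N` times the SERIES VALUE `Σ' [Xʲ]log_W · θ(y₀)ʲ`

Topic `Literature/NumberTheory/PAdicHodge`; namespace `Literature.NumberTheory.PAdicHodge.AinfTop`. THEOREMS ONLY (no definition, no named fact,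
no instance, no `sorry`). Generalisation of `BmaxPlusPhiRoadThetaBOmega.thetaBdR_bmaxPlusToBdR_logSum_divisionLiftPt` (depth `N = 1`, `‖u₀‖ ≤ ‖p‖`,
value `p·log_ω(P(u₀))`) to arbitrary `y₀ ∈ 𝔸_inf` with `θ(y₀) ∈ 𝔪_{ℂ_F}` and arbitrary nilpotence index `N` (`ι(y₀)^N = p·z`), in the currency of the
analytic files `SecondKindColmezFunctional{,Transport,HodgeLine}` (values `G(x) = Σ' [Xʲ]G·xʲ` of `log_W = (W.map (ℤ → ℂ_F)).formalLog`):

* `tendsto_sum_range_coeff_succ_formalLog_map_mul_pow` — the partial sums `Σ_{m<M} [X^{m+1}]log_W · x^{m+1}` of `thetaBdR_eq_of_tendsto`'s shape converge to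
  `Σ' [Xʲ]log_W · xʲ` for `‖x‖ < 1`;
* ★★ `thetaBdR_bmaxPlusToBdR_logSum_eq_pow_mul_tsum` — **`θ_dR(bmaxPlusToBdR (Λ_N(ι y₀, z))) = p^N · Σ' [Xʲ]log_W · θ(y₀)ʲ`**;
* ★★ `thetaBdR_bmaxPlusToBdR_logSum_torsionLift_eq_pow_mul_tsum` — for Fontaine's integral `y₀ = [w̃]` of an exact `[p]_W`-division tower `w` of
  `Ŵ(𝔪_{ℂ_F})` of ANY depth (`θ[w̃] = w₀`): **`θ_dR(f Λ_N(ι[w̃], z)) = p^N · log_W(w₀)`** (`log_W(w₀) := Σ' [Xʲ]log_W·w₀ʲ`).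

Purpose (crux K★ `stmt-BirchSwinnertonDyer-22226`, line `kato_lever`, memo `Lines/kato-lever-K2-ramified-cm-transport.md` §9, step T2): the CM-fibre
transport `w = Tu` of a K★ cell's tower has base point `w₀ ∈ ϖ𝒪_ℂ` of depth `N = e > 1`, outside the `‖u₀‖ ≤ ‖p‖` regime of the depth-1 file; this is
the first of the two θ-matchings `θ(f Λ_w) = p^N·log_{E₀}(w₀)`, `θ(f φΛ_w) = p^N·𝒞_w(log_{E₀}(Xᵖ))` that turn (HL-eval) (p769861 / p770176) into
`θ(f(A·Λ_w + B·φΛ_w)) = p^N·log_{W_D}(u₀)`. Infrastructure only; BSD / K★ are not proved by any of this.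

## References
* J.-M. Fontaine, *Formes différentielles et modules de Tate…*, Invent. Math. 65 (1982), §5. [Fontaine1982FormesDifferentielles]
* P. Colmez, *Théorie d'Iwasawa des représentations de de Rham d'un corps local*, Ann. of Math. 148 (1998), §III.2. [Colmez1998Annals]
* J. H. Silverman, *The Arithmetic of Elliptic Curves* (2009), IV.5.5, Thm. IV.6.4. [SilvermanAEC2009]
-/

noncomputable section

open Ideal WittVector ValuativeRel Field Filter Finset
open scoped Topology

namespace Literature.NumberTheory.PAdicHodge

namespace AinfTop

open Literature.NumberTheory.GaloisRepresentations Literature.NumberTheory.GaloisRepresentations.IsNonarchimedeanLocalField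
open Literature.NumberTheory.GaloisRepresentations.LubinTate Literature.NumberTheory.EllipticCurves
open Literature.RingTheory.FormalGroups Literature.AlgebraicGeometry.Resolution GaloisContinuity

variable {F : Type} [Field F] [ValuativeRel F] [TopologicalSpace F] [IsNonarchimedeanLocalField F]
  [CharZero F] {p : ℕ} [Fact p.Prime] [Fact (¬ IsUnit (p : integerC F))]
  [IsAdicComplete (Ideal.span {(p : integerC F)}) (integerC F)]
  {hθ : Function.Surjective (fontaineTheta (integerC F) p)} (W : WeierstrassCurve ℤ)

omit [Fact (¬ IsUnit (p : integerC F))] [IsAdicComplete (Ideal.span {(p : integerC F)}) (integerC F)] in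
/-- The coefficients of `log_W` read through `ℚ → ℚ_p → F → ℂ_F` are those of `log_{W ⊗ ℂ_F} = (W.map (ℤ → ℂ_F)).formalLog`.
[cite: SilvermanAEC2009, IV.5.5] -/
theorem algebraMap_padicRingHom_coeff_formalLog_eq_coeff_map [CharZero (CompletedAlgClosure F)] (hp : valuation F p < 1) (n : ℕ) :
    algebraMap F (CompletedAlgClosure F) (LocalField.padicRingHom F p hp (PowerSeries.coeff n (W.map (Int.castRingHom ℚ_[p])).formalLog)) =
      PowerSeries.coeff n (W.map (Int.castRingHom (CompletedAlgClosure F))).formalLog := by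
  have hint : (algebraMap ℚ (CompletedAlgClosure F)).comp (Int.castRingHom ℚ) = Int.castRingHom (CompletedAlgClosure F) := RingHom.ext_int _ _
  rw [algebraMap_padicRingHom_coeff_formalLog hp W n, ← PowerSeries.coeff_map, WeierstrassCurve.map_formalLog, WeierstrassCurve.map_map, hint]

omit [Fact (¬ IsUnit (p : integerC F))] [IsAdicComplete (Ideal.span {(p : integerC F)}) (integerC F)] in
/-- **The partial sums of `thetaBdR_eq_of_tendsto`'s shape converge to the series value**: for `‖x‖ < 1` in `ℂ_F`,
`Σ_{m<M} [X^{m+1}]log_W · x^{m+1} → Σ' [Xʲ]log_W · xʲ` (`[X⁰]log_W = 0`; `‖[Xʲ]log_W‖ ≤ j^k`). [cite: SilvermanAEC2009, Thm. IV.6.4] -/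
theorem tendsto_sum_range_coeff_succ_formalLog_map_mul_pow [CharZero (CompletedAlgClosure F)] (hp : valuation F p < 1)
    {x : CompletedAlgClosure F} (hx : ‖x‖ < 1) :
    Tendsto (fun M : ℕ => ∑ m ∈ range M,
      algebraMap F (CompletedAlgClosure F) (LocalField.padicRingHom F p hp (PowerSeries.coeff (m + 1) (W.map (Int.castRingHom ℚ_[p])).formalLog)) *
        x ^ (m + 1)) atTop
      (𝓝 (∑' j : ℕ, PowerSeries.coeff j (W.map (Int.castRingHom (CompletedAlgClosure F))).formalLog * x ^ j)) := by
  have hpC : ‖(p : CompletedAlgClosure F)‖ < 1 := norm_natCast_C_lt_one hp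
  obtain ⟨k, hk⟩ := exists_nat_norm_coeff_formalLog_map_le_pow (K := CompletedAlgClosure F) W hpC
  have h := (tendsto_sum_range_coeff_mul_pow (W.map (Int.castRingHom (CompletedAlgClosure F))).formalLog k hk hx).comp (tendsto_add_atTop_nat 1)
  refine h.congr fun M => ?_
  rw [Function.comp_apply, Finset.sum_range_succ', pow_zero, mul_one, PowerSeries.coeff_zero_eq_constantCoeff,
    WeierstrassCurve.constantCoeff_formalLog, add_zero]
  exact Finset.sum_congr rfl fun m _ => by rw [algebraMap_padicRingHom_coeff_formalLog_eq_coeff_map W hp]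

set_option maxHeartbeats 1600000 in
/-- ★★ **`θ_dR(bmaxPlusToBdR (Λ_N(ι y₀, z))) = p^N · Σ' [Xʲ]log_W · θ(y₀)ʲ`** for every `y₀ ∈ 𝔸_inf` with `‖θ(y₀)‖ < 1` and every nilpotence witness
`ι(y₀)^N = p·z` (`N ≥ 1`): the honest image is `p^N·L′` with `L′` THE value of `log_W(ι y₀)` modulo every `Fil^k` (`exists_forall_isFormalLogModFil_bmaxPlusToBdR_logSum`)
and `θ(L′)` is the limit of the partial sums of `log_W` at `θ(y₀)` (`IsFormalLogModFil.thetaBdR_eq_of_tendsto`), i.e. the series value.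
[cite: Fontaine1982FormesDifferentielles, §5] [cite: Colmez1998Annals, §III.2] -/
theorem thetaBdR_bmaxPlusToBdR_logSum_eq_pow_mul_tsum [CharZero (CompletedAlgClosure F)] (hp : valuation F p < 1) {N : ℕ} (hN : 1 ≤ N)
    (y₀ : Ainf (p := p) F) (hy : ‖thetaBdR (ainfToBdR y₀)‖ < 1) {z : bmaxZero F p}
    (hz : algebraMap (Ainf (p := p) F) (bmaxZero F p) y₀ ^ N = (p : bmaxZero F p) * z) :
    thetaBdR (bmaxPlusToBdR F p
      (PadicLogSeries.logSum ((algebraMap (Ainf (p := p) F) (bmaxZero F p)).comp zpToAinf) (GaloisContinuity.formalLogNum W p) N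
        (algebraMap (Ainf (p := p) F) (bmaxZero F p) y₀) z)) =
      (p : CompletedAlgClosure F) ^ N *
        ∑' j : ℕ, PowerSeries.coeff j (W.map (Int.castRingHom (CompletedAlgClosure F))).formalLog * (thetaBdR (ainfToBdR y₀)) ^ j := by
  obtain ⟨L', hL'eq, hL'⟩ := exists_forall_isFormalLogModFil_bmaxPlusToBdR_logSum W hN y₀ hz
  have hθL' : thetaBdR L' = ∑' j : ℕ, PowerSeries.coeff j (W.map (Int.castRingHom (CompletedAlgClosure F))).formalLog * (thetaBdR (ainfToBdR y₀)) ^ j :=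
    IsFormalLogModFil.thetaBdR_eq_of_tendsto hp le_rfl (hL' 1) (tendsto_sum_range_coeff_succ_formalLog_map_mul_pow W hp hy)
  rw [← hL'eq, map_mul, map_pow, map_natCast, hθL']

set_option maxHeartbeats 1600000 in
/-- ★★ **`θ_dR(f Λ_N(ι[w̃], z)) = p^N · log_W(w₀)` for a `[p]_W`-division tower of ANY depth.** For an exact `[p]_W`-division sequence `w` of `Ŵ(𝔪_{ℂ_F})`
(`w₀` arbitrary in `𝔪_{ℂ_F}`), Fontaine's integral `[w̃]` and any witness `ι[w̃]^N = p·z`: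
`θ_dR(bmaxPlusToBdR (Λ_N(ι[w̃], z))) = p^N · Σ' [Xʲ]log_W · w₀ʲ`. (At depth `N = 1`, `‖w₀‖ ≤ ‖p‖`, the series is `log_ω(P(w₀))` and this is
`thetaBdR_bmaxPlusToBdR_logSum_divisionLiftPt`.) [cite: Fontaine1982FormesDifferentielles, §5] [cite: Colmez1998Annals, §III.2] -/
theorem thetaBdR_bmaxPlusToBdR_logSum_torsionLift_eq_pow_mul_tsum [CharZero (CompletedAlgClosure F)] (hp : valuation F p < 1) {N : ℕ} (hN : 1 ≤ N)
    {w : ℕ → (maxNilIdealC F).toIdeal} (hw : ∀ n, mulPC F p W (w (n + 1)) = w n) {z : bmaxZero F p}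
    (hz : algebraMap (Ainf (p := p) F) (bmaxZero F p) ((of F p).symm (torsionLift W hθ w hw)) ^ N = (p : bmaxZero F p) * z) :
    thetaBdR (bmaxPlusToBdR F p
      (PadicLogSeries.logSum ((algebraMap (Ainf (p := p) F) (bmaxZero F p)).comp zpToAinf) (GaloisContinuity.formalLogNum W p) N
        (algebraMap (Ainf (p := p) F) (bmaxZero F p) ((of F p).symm (torsionLift W hθ w hw))) z)) =
      (p : CompletedAlgClosure F) ^ N *
        ∑' j : ℕ, PowerSeries.coeff j (W.map (Int.castRingHom (CompletedAlgClosure F))).formalLog *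
          (((w 0 : (maxNilIdealC F).toIdeal) : CBall F) : CompletedAlgClosure F) ^ j := by
  have hθ0 := thetaBdR_ainfToBdR_torsionLift (hθ := hθ) W w hw
  have hy : ‖thetaBdR (ainfToBdR ((of F p).symm (torsionLift W hθ w hw)))‖ < 1 := by rw [hθ0]; exact (w 0).2
  rw [thetaBdR_bmaxPlusToBdR_logSum_eq_pow_mul_tsum W hp hN _ hy hz, hθ0]

end AinfTop

end Literature.NumberTheory.PAdicHodge
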